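import Summits.CriticalPhenomena.PercolationContinuityZ3.Theorems.PercNearOneGluingNoHeavyLowerTailSahiCombTriWFaceMin

/-!
# The universal face-minimum statement `FaceMinIneq` is false

`FiveUpSet.FaceMinIneq` (prim-masterthm-p5 gen 17, `…SahiCombTriWFaceMin`) asks that for EVERY coordinate `i` of the cube
`min (triW P⁰ F⁰ G⁰) (triW P¹ F¹ G¹) ≤ triW P F G` (bottom / top faces along `i`).  The owner's census (kit j140111, 2.63·10⁹ sampled
instances; `prim-masterthm-p5/code17/facemin-census-j140111.md`) found three counterexamples at `(n,a) = (5,1)`.  This file decides the first one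
in the kernel: index cube `Finset (Fin 1)` (`a = 1`), cube `Finset (Fin 5)` (`n = 5`), coordinate `i = 4`;
* `P` = the up-set with bit mask `0xfaa0e000` (the 11 sets with characteristic numbers `13,14,15,21,23,25,27,28,29,30,31`),
* `F ∅ ⊆ F {0}` = masks `0xfeeafaa0 ⊆ 0xfefefeee`,  `G ∅ = ∅ ⊆ G {0}` = mask `0xcccccccc`
(a set `s ⊆ Fin 5` is read as the number `Σ_{j∈s} 2^j`).  Here `triW P F G = 1` while BOTH faces along `4` have `triW = 2`, so the universal
statement fails; coordinates `0,…,3` satisfy it, so the EXISTENTIAL form `FaceMinExistsIneq` — the one the induction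
`triWIneq_of_faceMinExistsIneq` uses — is not affected (it remains census-clean, owner's census above).  The same numbers were re-derived
independently in exact integer arithmetic from the definitions (`triW = 1`, `(B_i,U_i) = (2,0),(0,0),(0,2),(0,2),(2,2)`).

HONEST LABEL: refutation of a conjecture of this theory by an explicit finite witness, decided by `decide`; nothing is claimed about
`TriWIneq` or `FaceMinExistsIneq`. [this work]
-/

namespace Summit.CriticalPhenomena.PercolationContinuityZ3.Theorems

namespace FiveUpSet

open Finset

/-- Plumbing for `decide`: an up-set check over the finite powerset of `Fin 5`. [folklore] -/
private theorem isUpperSet_of_forall5 {A : Finset (Finset (Fin 5))}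
    (h : ∀ a ∈ (univ : Finset (Finset (Fin 5))), ∀ b ∈ (univ : Finset (Finset (Fin 5))), a ⊆ b → a ∈ A → b ∈ A) :
    IsUpperSet (A : Set (Finset (Fin 5))) := fun a b hab ha =>
  mem_coe.2 (h a (mem_univ a) b (mem_univ b) hab (mem_coe.1 ha))

/-- Plumbing for `decide`: monotonicity of a family over the index cube `Finset (Fin 1)`. [folklore] -/
private theorem monotone_of_forall1 {H : Finset (Fin 1) → Finset (Finset (Fin 5))}
    (h : ∀ x ∈ (univ : Finset (Finset (Fin 1))), ∀ y ∈ (univ : Finset (Finset (Fin 1))), x ⊆ y → H x ⊆ H y) :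
    Monotone H := fun x y hxy => h x (mem_univ x) y (mem_univ y) hxy

/-- **`FaceMinIneq` is false.**  Witness: `a = 1`, `n = 5`, `i = 4`, `P = 0xfaa0e000`, `F = (0xfeeafaa0 ⊆ 0xfefefeee)`,
`G = (∅ ⊆ 0xcccccccc)` (owner's witness #1 of kit j140111, prim-masterthm-p5 gen 17): `triW P F G = 1 < 2 = min` of the two faces along `4`.
The up-set / monotonicity hypotheses and the final inequality are all decided by `decide`. [this work] -/
theorem not_faceMinIneq : ¬ FaceMinIneq := by
  intro h
  have key := h (Fin 1) (Fin 5) (4 : Fin 5)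
    (Finset.univ.filter fun s : Finset (Fin 5) => Nat.testBit 4204847104 (∑ j ∈ s, 2 ^ (j : ℕ)))
    (fun x : Finset (Fin 1) => if (0 : Fin 1) ∈ x then (Finset.univ.filter fun s : Finset (Fin 5) => Nat.testBit 4278124270 (∑ j ∈ s, 2 ^ (j : ℕ))) else (Finset.univ.filter fun s : Finset (Fin 5) => Nat.testBit 4276812448 (∑ j ∈ s, 2 ^ (j : ℕ))))
    (fun x : Finset (Fin 1) => if (0 : Fin 1) ∈ x then (Finset.univ.filter fun s : Finset (Fin 5) => Nat.testBit 3435973836 (∑ j ∈ s, 2 ^ (j : ℕ))) else (∅ : Finset (Finset (Fin 5))))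
    (isUpperSet_of_forall5 (by decide))
    (fun x => by split_ifs <;> exact isUpperSet_of_forall5 (by decide))
    (fun x => by split_ifs <;> exact isUpperSet_of_forall5 (by decide))
    (monotone_of_forall1 (by decide))
    (monotone_of_forall1 (by decide))
  exact absurd key (by decide)

end FiveUpSet

end Summit.CriticalPhenomena.PercolationContinuityZ3.Theorems
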